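import Summits.RiemannHypothesis.RiemannHypothesis.Theorems.OddSectorOddOneSignedWindowsFormDomainDilation
import Summits.RiemannHypothesis.RiemannHypothesis.Theorems.WeilGroundStateMarkovPartPositiveGroundStateLsc
import HarnessLib

/-!
# RiemannHypothesis / GroundBarta — crux `PolarPerronFrobenius` (stmt-RiemannHypothesis-18390):
# parity-free form-domain tools and even non-negative mollification

Helper file (`--supports stmt-RiemannHypothesis-18390`), RH-free, Mathlib + landed tree files only, no
definitions, no named facts.  Infrastructure for `Theorems/GroundBartaPolarPerronFrobeniusConeDenseOfOneSigned.lean`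
(SIGN ⇒ CONE DENSITY): the odd-sector form-domain tools
(`Theorems/OddSectorOddOneSignedWindowsFormDomain*.lean`, crux `OddOneSignedWindows`) with the parity
hypothesis — used there only to pick approximants — removed, plus the even non-negative mollifier.

* `continuous_weilIncrement_of_memLp_window` — `t ↦ D_t(f)` is continuous for `f ∈ L²` on a window;
* `tendsto_integral_norm_sq_weilDilate_sub_window` — `f_η → f` in `L²` as `η → 0⁺`;
* `tendsto_weilDirichletEnergy_weilDilate_window` — `𝓔_a(f_η) → 𝓔_a(f)` for finite-energy `f`
  (dominated convergence in the jump length, `OddSector.tendsto_archEnergy_weilDilate`);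
* `weilDirichletEnergy_le_of_increment_le` — `𝓔_a` is monotone in the increments;
* `exists_even_nonneg_mollified_seq` — mollification by even non-negative normalised bumps keeps a window
  function EVEN and pointwise real `≥ 0`, contracts every increment (`weilIncrement_mollify_le`) and
  converges in `L²`.

Prover B, speedrun unit `sr-gb-rung-b` (seat 3).  References: M. Fukushima, Y. Oshima, M. Takeda,
*Dirichlet Forms and Symmetric Markov Processes* (2011) §1.1, Ex. 1.4.1; E. Bombieri, Rend. Lincei (9) 11
(2000) §4 (dilations, proof of Thm 5).
-/

set_option linter.dupNamespace false

noncomputable section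

open MeasureTheory Complex Filter Set ContinuousLinearMap
open scoped Real Topology Convolution

namespace Summit.RiemannHypothesis.RiemannHypothesis.Theorems.PolarPerronFrobenius

open Literature.NumberTheory.LFunctions
open Summit.RiemannHypothesis.RiemannHypothesis.Theorems.WeilGroundStateMarkovPart
open Summit.RiemannHypothesis.RiemannHypothesis.Theorems.OddSector
  (memLp_weilDilate abs_sqrt_integral_norm_sq_sub_sqrt_le tendsto_archEnergy_weilDilate
    tendsto_integral_norm_sq_weilDilate_sub weilDilate_sub)

/-! ### Parity-free form-domain tools -/

/-- **`t ↦ D_t(f)` is continuous** for `f ∈ L²` vanishing off a window (parity-free form of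
`OddSector.continuous_weilIncrement_of_memLp`): `√D_t` is the uniform limit of the continuous
`√D_t(gₙ)` along mollified test functions `gₙ → f`. [folklore] -/
theorem continuous_weilIncrement_of_memLp_window {b : ℝ} {f : ℝ → ℂ} (hf : MemLp f 2)
    (hfs : ∀ x, x ∉ Icc (-b) b → f x = 0) :
    Continuous (weilIncrement f) := by
  -- adapted from `OddSector.continuous_weilIncrement_of_memLp`
  obtain ⟨g, hgt, -, -, hglim⟩ := exists_mollified_seq hf hfs
  have hgm : ∀ m, MemLp (g m) 2 := fun m ↦ (hgt m).memLp_two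
  have hunif : TendstoUniformly (fun m t ↦ Real.sqrt (weilIncrement (g m) t))
      (fun t ↦ Real.sqrt (weilIncrement f t)) atTop := by
    rw [Metric.tendstoUniformly_iff]
    intro ε hε
    have hev : ∀ᶠ m in atTop, ∫ x, ‖g m x - f x‖ ^ 2 < (ε / 2) ^ 2 / 4 :=
      hglim.eventually (eventually_lt_nhds (by positivity))
    filter_upwards [hev] with m hm t
    have hF : MemLp (fun x ↦ f (x + t) - f x) 2 :=
      (hf.comp_measurePreserving (measurePreserving_add_right volume t)).sub hf
    have hG : MemLp (fun x ↦ g m (x + t) - g m x) 2 :=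
      ((hgm m).comp_measurePreserving (measurePreserving_add_right volume t)).sub (hgm m)
    have h1 := abs_sqrt_integral_norm_sq_sub_sqrt_le hF hG
    have h2 := integral_norm_sq_increment_sub_le hf (hgm m) t
    rw [Real.dist_eq]
    unfold weilIncrement
    have h3 : Real.sqrt (∫ x, ‖(f (x + t) - f x) - (g m (x + t) - g m x)‖ ^ 2) ≤
        Real.sqrt (4 * ∫ x, ‖f x - g m x‖ ^ 2) := Real.sqrt_le_sqrt h2
    have h4 : Real.sqrt (4 * ∫ x, ‖f x - g m x‖ ^ 2) < ε := by
      have e : ∫ x, ‖f x - g m x‖ ^ 2 = ∫ x, ‖g m x - f x‖ ^ 2 :=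
        integral_congr_ae (Eventually.of_forall fun x ↦ by beta_reduce; rw [← norm_neg, neg_sub])
      rw [e, Real.sqrt_lt' hε]
      nlinarith [hm, hε]
    have h1' := (abs_sub_comm _ _).trans_le h1
    linarith [h1, h1', h3, h4]
  have hcont : Continuous fun t ↦ Real.sqrt (weilIncrement f t) :=
    hunif.continuous (Eventually.of_forall fun m ↦
      (continuous_weilIncrement (hgt m)).sqrt).frequently
  have e : weilIncrement f = fun t ↦ (Real.sqrt (weilIncrement f t)) ^ 2 := by
    funext t; rw [Real.sq_sqrt (weilIncrement_nonneg f t)]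
  rw [e]
  exact hcont.pow 2

/-- **Strong continuity of dilation at `η → 0⁺` on `L²` window functions** (parity-free form of
`OddSector.tendsto_integral_norm_sq_weilDilate_sub_of_memLp`). [folklore] -/
theorem tendsto_integral_norm_sq_weilDilate_sub_window {b : ℝ} {f : ℝ → ℂ} (hf : MemLp f 2)
    (hfs : ∀ x, x ∉ Icc (-b) b → f x = 0) {η : ℕ → ℝ}
    (hη0 : ∀ n, 0 ≤ η n) (hη1 : ∀ n, η n ≤ 1) (hη : Tendsto η atTop (𝓝 0)) :
    Tendsto (fun n ↦ ∫ x, ‖weilDilate (η n) f x - f x‖ ^ 2) atTop (𝓝 0) := by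
  -- adapted from `OddSector.tendsto_integral_norm_sq_weilDilate_sub_of_memLp`
  obtain ⟨g, hgt, -, -, hglim⟩ := exists_mollified_seq hf hfs
  have hηm1 : ∀ n, -1 < η n := fun n ↦ by linarith [hη0 n]
  have hgm : ∀ m, MemLp (g m) 2 := fun m ↦ (hgt m).memLp_two
  have hbnd : ∀ n m, ∫ x, ‖weilDilate (η n) f x - f x‖ ^ 2 ≤
      (8 * ∫ x, ‖g m x - f x‖ ^ 2) + 4 * ∫ x, ‖weilDilate (η n) (g m) x - g m x‖ ^ 2 := by
    intro n m
    have hfd : MemLp (weilDilate (η n) f) 2 := memLp_weilDilate hf (hηm1 n)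
    have hgd : MemLp (weilDilate (η n) (g m)) 2 := memLp_weilDilate (hgm m) (hηm1 n)
    have s1 := integral_norm_sq_add_le (hfd.sub hgd) (hgd.sub hf)
    have e1 : (fun x ↦ ‖(weilDilate (η n) f - weilDilate (η n) (g m)) x +
        (weilDilate (η n) (g m) - f) x‖ ^ 2) = fun x ↦ ‖weilDilate (η n) f x - f x‖ ^ 2 := by
      funext x; simp only [Pi.sub_apply, sub_add_sub_cancel]
    rw [e1] at s1
    have e2 : ∫ x, ‖(weilDilate (η n) f - weilDilate (η n) (g m)) x‖ ^ 2 =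
        ∫ x, ‖f x - g m x‖ ^ 2 := by
      have : (weilDilate (η n) f - weilDilate (η n) (g m)) =
          weilDilate (η n) (fun t ↦ f t - g m t) := by
        rw [weilDilate_sub]; rfl
      rw [this, integral_norm_sq_weilDilate _ (hηm1 n)]
    rw [e2] at s1
    have s2 := integral_norm_sq_add_le (hgd.sub (hgm m)) ((hgm m).sub hf)
    have e3 : (fun x ↦ ‖(weilDilate (η n) (g m) - g m) x + (g m - f) x‖ ^ 2) =
        fun x ↦ ‖(weilDilate (η n) (g m) - f) x‖ ^ 2 := by
      funext x; simp only [Pi.sub_apply, sub_add_sub_cancel]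
    rw [e3] at s2
    have e4 : ∫ x, ‖f x - g m x‖ ^ 2 = ∫ x, ‖g m x - f x‖ ^ 2 :=
      integral_congr_ae (Eventually.of_forall fun x ↦ by simp only [norm_sub_rev])
    rw [e4] at s1
    have hA0 : 0 ≤ ∫ x, ‖g m x - f x‖ ^ 2 := integral_nonneg fun _ ↦ by positivity
    simp only [Pi.sub_apply] at s1 s2 ⊢
    linarith
  rw [Metric.tendsto_atTop]
  intro ε hε
  obtain ⟨m, hm⟩ : ∃ m, ∫ x, ‖g m x - f x‖ ^ 2 < ε / 16 :=
    ((Metric.tendsto_atTop.1 hglim) (ε / 16) (by positivity)).imp fun m h ↦ by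
      have := h m le_rfl
      rw [Real.dist_eq, sub_zero, abs_of_nonneg (integral_nonneg fun _ ↦ by positivity)] at this
      exact this
  have hDil := tendsto_integral_norm_sq_weilDilate_sub (hgt m) hη0 hη1 hη
  obtain ⟨N, hN⟩ := (Metric.tendsto_atTop.1 hDil) (ε / 8) (by positivity)
  refine ⟨N, fun n hn ↦ ?_⟩
  have h2 := hN n hn
  rw [Real.dist_eq, sub_zero, abs_of_nonneg (integral_nonneg fun _ ↦ by positivity)] at h2 ⊢
  linarith [hbnd n m]

/-- **The energy of dilates converges** (parity-free form of
`OddSector.tendsto_weilDirichletEnergy_weilDilate`): for `f ∈ L²` living on `[-b, b]` with finite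
archimedean energy, `𝓔_a(f_{ηₙ}) → 𝓔_a(f)` along `0 ≤ ηₙ ≤ 1`, `ηₙ → 0`, and every dilate has finite
archimedean energy. [folklore] -/
theorem tendsto_weilDirichletEnergy_weilDilate_window (a : ℝ) {b : ℝ} (hb : 0 < b) {f : ℝ → ℂ}
    (hf : MemLp f 2) (hfs : ∀ x, x ∉ Icc (-b) b → f x = 0)
    (hE : IntegrableOn (fun t ↦ weilArchDensity t * weilIncrement f t) (Ioi 0))
    {η : ℕ → ℝ} (hη0 : ∀ n, 0 ≤ η n) (hη1 : ∀ n, η n ≤ 1) (hη : Tendsto η atTop (𝓝 0)) :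
    (∀ n, IntegrableOn (fun t ↦ weilArchDensity t * weilIncrement (weilDilate (η n) f) t) (Ioi 0)) ∧
    Tendsto (fun n ↦ weilDirichletEnergy a (weilDilate (η n) f)) atTop
      (𝓝 (weilDirichletEnergy a f)) := by
  have hD : Continuous (weilIncrement f) := continuous_weilIncrement_of_memLp_window hf hfs
  have hηm1 : ∀ n, -1 < η n := fun n ↦ by linarith [hη0 n]
  obtain ⟨hint, harch⟩ := tendsto_archEnergy_weilDilate hb hf hfs hD hE hη0 hη1 hη
  refine ⟨hint, ?_⟩
  have hprime : ∀ p : ℕ, Tendsto (fun n ↦ weilIncrement (weilDilate (η n) f) (Real.log p)) atTop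
      (𝓝 (weilIncrement f (Real.log p))) := by
    intro p
    simp only [weilIncrement_weilDilate f (hηm1 _)]
    have h1 : Tendsto (fun n ↦ (1 + η n) * Real.log p) atTop (𝓝 ((1 + 0) * Real.log p)) :=
      (tendsto_const_nhds.add hη).mul_const _
    rw [add_zero, one_mul] at h1
    exact (hD.tendsto _).comp h1
  unfold weilDirichletEnergy
  exact (tendsto_finsetSum _ fun p _ ↦ (hprime p).const_mul _).add harch

/-- **The Dirichlet energy is monotone in the increments**: if `D_t(g) ≤ D_t(f)` for every `t` and both
archimedean energies converge, then `𝓔_a(g) ≤ 𝓔_a(f)` (non-negative jump rates and density).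
[folklore] -/
theorem weilDirichletEnergy_le_of_increment_le {a : ℝ} {f g : ℝ → ℂ}
    (hle : ∀ t, weilIncrement g t ≤ weilIncrement f t)
    (hg : IntegrableOn (fun t ↦ weilArchDensity t * weilIncrement g t) (Ioi 0))
    (hf : IntegrableOn (fun t ↦ weilArchDensity t * weilIncrement f t) (Ioi 0)) :
    weilDirichletEnergy a g ≤ weilDirichletEnergy a f := by
  unfold weilDirichletEnergy
  refine add_le_add (Finset.sum_le_sum fun n _ ↦ ?_) ?_
  · exact mul_le_mul_of_nonneg_left (hle _)
      (div_nonneg ArithmeticFunction.vonMangoldt_nonneg (Real.sqrt_nonneg _))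
  · refine setIntegral_mono_on hg hf measurableSet_Ioi fun t ht ↦ ?_
    exact mul_le_mul_of_nonneg_left (hle t) (weilArchDensity_pos ht).le

/-! ### Even, non-negative mollification -/

/-- **Even non-negative mollified approximants.**  For `f ∈ L²` vanishing off `[-b, b]`, EVEN and
pointwise real `≥ 0`, the mollifications `gₙ = Kₙ ⋆ f` by normalised (even, non-negative) bumps of outer
radius `1/(n+1)` are even, pointwise real `≥ 0` test functions supported in
`[-(b + 1/(n+1)), b + 1/(n+1)]`, with `D_t(gₙ) ≤ D_t(f)` for every `t`, converging to `f` in `L²`.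
[folklore] -/
theorem exists_even_nonneg_mollified_seq {b : ℝ} {f : ℝ → ℂ} (hf : MemLp f 2)
    (hfs : ∀ x, x ∉ Icc (-b) b → f x = 0) (hfe : ∀ x, f (-x) = f x)
    (hfr : ∀ x, (f x).im = 0 ∧ 0 ≤ (f x).re) :
    ∃ g : ℕ → ℝ → ℂ,
      (∀ n, IsWeilTest (g n)) ∧ (∀ n x, g n (-x) = g n x) ∧ (∀ n x, (g n x).im = 0 ∧ 0 ≤ (g n x).re) ∧
      (∀ n, tsupport (g n) ⊆ Icc (-(b + 1 / ((n : ℝ) + 1))) (b + 1 / ((n : ℝ) + 1))) ∧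
      (∀ n t, weilIncrement (g n) t ≤ weilIncrement f t) ∧
      Tendsto (fun n ↦ ∫ x, ‖g n x - f x‖ ^ 2) atTop (𝓝 0) := by
  -- adapted from `WeilGroundStateMarkovPart.exists_mollified_seq` / `OddSector.exists_odd_mollified_seq`
  set φ : ℕ → ContDiffBump (0 : ℝ) := fun n ↦
    ⟨1 / ((n : ℝ) + 2), 1 / ((n : ℝ) + 1), by positivity,
      one_div_lt_one_div_of_lt (by positivity) (by linarith)⟩
  have hrOut : ∀ n, (φ n).rOut = 1 / ((n : ℝ) + 1) := fun n ↦ rfl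
  have hfl : LocallyIntegrable f volume := hf.locallyIntegrable one_le_two
  have hfc : HasCompactSupport f := HasCompactSupport.intro isCompact_Icc hfs
  have hmem : ∀ n, MemLp ((φ n).normed volume ⋆[lsmul ℝ ℝ, volume] f) 2 volume := fun n ↦
    Literature.Analysis.UnboundedOperators.memLp_convolution_lsmul (φ n).integrable_normed hf
      one_le_two
  -- the real profile of `f`
  have hfre : ∀ x, f x = (((f x).re : ℝ) : ℂ) := fun x ↦
    Complex.ext (by simp) (by simp [(hfr x).1])
  have heven : ∀ n x, ((φ n).normed volume ⋆[lsmul ℝ ℝ, volume] f) (-x) =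
      ((φ n).normed volume ⋆[lsmul ℝ ℝ, volume] f) x := by
    intro n x
    simp only [convolution_lsmul]
    rw [← integral_neg_eq_self]
    refine integral_congr_ae (Eventually.of_forall fun t ↦ ?_)
    simp only [(φ n).normed_neg, show -x - -t = -(x - t) by ring, hfe]
  have hreal : ∀ n x, (((φ n).normed volume ⋆[lsmul ℝ ℝ, volume] f) x).im = 0 ∧
      0 ≤ (((φ n).normed volume ⋆[lsmul ℝ ℝ, volume] f) x).re := by
    intro n x
    have e : ((φ n).normed volume ⋆[lsmul ℝ ℝ, volume] f) x =
        ((∫ t, (φ n).normed volume t * (f (x - t)).re : ℝ) : ℂ) := by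
      simp only [convolution_lsmul]
      rw [← integral_complex_ofReal]
      refine integral_congr_ae (Eventually.of_forall fun t ↦ ?_)
      simp only [Complex.real_smul, Complex.ofReal_mul]
      rw [← hfre]
    rw [e, Complex.ofReal_im, Complex.ofReal_re]
    exact ⟨rfl, integral_nonneg fun t ↦ mul_nonneg ((φ n).nonneg_normed t) (hfr _).2⟩
  refine ⟨fun n ↦ (φ n).normed volume ⋆[lsmul ℝ ℝ, volume] f, fun n ↦ ⟨?_, ?_⟩, heven, hreal,
    fun n ↦ ?_, fun n t ↦ weilIncrement_mollify_le (φ n) hf t, ?_⟩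
  · exact ((φ n).hasCompactSupport_normed (μ := volume)).contDiff_convolution_left _
      (φ n).contDiff_normed hfl
  · exact ((φ n).hasCompactSupport_normed (μ := volume)).convolution _ hfc
  · refine closure_minimal (fun x hx ↦ ?_) isClosed_Icc
    obtain ⟨y, hy, z, hz, rfl⟩ := support_convolution_subset (L := lsmul ℝ ℝ) (μ := volume)
      (f := (φ n).normed volume) (g := f) hx
    rw [(φ n).support_normed_eq, hrOut, Metric.mem_ball, dist_zero_right, Real.norm_eq_abs,
      abs_lt] at hy
    have hz' : z ∈ Icc (-b) b := not_not.1 fun h ↦ hz (hfs z h)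
    constructor <;> linarith [hz'.1, hz'.2, hy.1, hy.2]
  · have hT := Literature.Analysis.FunctionSpaces.tendsto_eLpNorm_normed_convolution_sub_self
      (μ := volume) (φ := φ) (l := atTop)
      (tendsto_one_div_add_atTop_nhds_zero_nat (𝕜 := ℝ)) one_le_two ENNReal.ofNat_ne_top hf
    have hT' : Tendsto (fun n ↦ Real.sqrt
        (∫ x, ‖((φ n).normed volume ⋆[lsmul ℝ ℝ, volume] f) x - f x‖ ^ 2)) atTop (𝓝 0) := by
      have h2 := (ENNReal.tendsto_toReal ENNReal.zero_ne_top).comp hT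
      rw [ENNReal.toReal_zero] at h2
      refine h2.congr fun n ↦ ?_
      rw [Function.comp_apply, eLpNorm_two_eq_ofReal_sqrt ((hmem n).sub hf),
        ENNReal.toReal_ofReal (Real.sqrt_nonneg _)]
      rfl
    have h3 := hT'.pow 2
    rw [zero_pow two_ne_zero] at h3
    refine h3.congr fun n ↦ ?_
    exact Real.sq_sqrt (integral_nonneg fun _ ↦ by positivity)

end Summit.RiemannHypothesis.RiemannHypothesis.Theorems.PolarPerronFrobenius

end
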